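import Summits.BirchSwinnertonDyer.BirchSwinnertonDyer.Theorems.SemiOrdinaryEisensteinDescentShaTwoCochainBridgeData
import Summits.BirchSwinnertonDyer.BirchSwinnertonDyer.Theorems.SemiOrdinaryEisensteinDescentShaTwoCochainBridgeDataLocal
import Summits.BirchSwinnertonDyer.BirchSwinnertonDyer.Theorems.SemiOrdinaryEisensteinDescentShaTwoCochainBridgeDataPlace
import HarnessLib

/-!
# The Ш²-cochain bridge, PACKAGED: one theorem producing, for `h : N₁ → C̄` and a `1`-cocycle `γ` of `M`, the connecting
# cocycle `F` of `Ψ h`, a global primitive `H` of `F ∪ γ`, the idèle `2`-cocycle `Z` with class image `h ∘ ∂γ`, and at every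
# place a local primitive `φ_v` of `ι_v F` with `φ_v ∪ γ − ι_v H = π_v Z − dλ_v` ON THE NOSE (step S2 of SHA2-BRIDGE-w3g7, assembled)

Route `SemiOrdinaryEisensteinDescent` (BSD), Kolyvagin column, Cassels–Tate lane: print item `CasselsTateLevelInputsFact`
(stmt-BirchSwinnertonDyer-20191), remaining binder `hbridge` of `ShaTwoCochainTheta.casselsTate_levelInputs_of_readout_vanishing`
(p638776).  This file HIDES the intermediate letters `ξ, ξ̃, γ̃, B, η̃` of the six bridge files (S2a p634550 `…BridgeIdele`, S2b
p635080 `…BridgeLocal`, S2-inst (G) p638692 `…BridgeData`, (H) p639305 `…BridgeDataLocal`, (L) p639835 `…BridgeDataPlace`) behind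
ONE existence statement on road B's objects (`presModule₁ ρ = N₁`, `presIncl/presProj`, `unitsToIdeleI K : K̄ˣ → J̄`,
`ideleToClassI K : J̄ → C̄`, `tateDualUnitsIso`, `shaTwoConnecting`, an idèle projection `π_v : HomDual.IdeleProjection K v` read on
`LCarrier (ideleBarD K)`, the units transfer `ι_v = unitsTransfer K K_v : K̄ˣ → K̄_vˣ`):

* **`exists_bridgePackage`** — for `ρ` finite `n`-torsion (`hM`), `H³(K, μₙ) = 0` (`hH3`), `h : N₁ ⟶ C̄` in `C_Γ` and
  `γ ∈ Z¹(K, M)`, THERE ARE `F ∈ Z²(K, Hom(M, K̄ˣ))`, `H : C(Γ_K², K̄ˣ)`, `c ∈ Z²(K, N₁)`, `h̃ : Hom(N₁, J̄)`, `Z ∈ Z²(K, J̄)` with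
  (1) `Ψ h = H²(e⁻¹)[F]`; (2) `F(σ,τ)(στ γ(υ)) = dH(σ,τ,υ)`; (3) `jC ∘ h̃ = h`; (4) `δ₁[γ] = [c]` for the presentation
  `0 → N₁ → P → M → 0`; (5) `jC (Z(σ,τ)) = h (c(σ,τ))` (so `(jC)_*[Z] = h_*(δ₁[γ])` in `H²(K, C̄)`); (6) at every place `v` and
  every idèle projection `π_v`: a continuous `φ_v : Γ_v → Hom(M, K̄_vˣ)` with `dφ_v = ι_v ∘ F|_v` pointwise and a continuous
  `λ_v : Γ_v → K̄_vˣ` with `φ_v(σ')(σ' γ(θτ')) − ι_v H(θσ',θτ') = π_v Z(θσ',θτ') − (σ'λ_v(τ') − λ_v(σ'τ') + λ_v(σ'))`.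
  In words: `(H; φ_v)` is an admissible cochain choice for the Poitou–Tate value `⟨[F], [γ]⟩` (evaluation pairing, `K̄ˣ`/`K̄_vˣ`
  coefficients) whose local `2`-cocycles are the projections `π_v Z` of ONE global idèle cocycle `Z`, up to explicit local
  coboundaries; the idèle-class image of `Z` is the cocycle `h ∘ c` of `h_*(δ₁[γ])`.  The sum of the local invariants of `Z` is
  then computed by class field theory on `C̄` (step S3, seat w2), and compared with `hPTc`'s `μ_{n}`-valued local terms through
  choice independence (S1/S1′) and the Weil transport (step E).

Width seat `bsd-wall-soed-p2-w3` g7; `--supports stmt-BirchSwinnertonDyer-20480`, helper.  THEOREMS ONLY; no case of BSD,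
Poitou–Tate or Cassels–Tate is proved here.

## References
* [MilneADT2006] J. S. Milne, *Arithmetic Duality Theorems*, 2nd ed. (2006), I §0 (0.8), Thm. 4.10 (a) (proof, p. 58),
  Lemma 4.13, §6 proof of Prop. 6.9.
* [NeukirchSchmidtWingberg2008] J. Neukirch, A. Schmidt, K. Wingberg, *Cohomology of Number Fields*, 2nd ed. (2008), (1.3.2),
  Prop. 1.4.1, (1.5.2), (8.1.1).
* [SerreGaloisCohomology1997] J.-P. Serre, *Galois Cohomology* (1997), I §2.2, II §1.2.
-/

noncomputable section

-- `Summit.<P>.<Sub>` repeats `BirchSwinnertonDyer` by the tree's layout convention (D-0017)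
set_option linter.dupNamespace false
set_option autoImplicit false

namespace Summit.BirchSwinnertonDyer.BirchSwinnertonDyer.Theorems.ShaTwoCochain

open CategoryTheory NumberField
open Literature.NumberTheory.GaloisRepresentations Literature.NumberTheory.GaloisRepresentations.HomDual
open Literature.Algebra.Homology Literature.Algebra.Homology.DiscreteRep ContRepresentation Field Literature
open Literature.NumberTheory.GaloisRepresentations.DiscreteGaloisModule (units UnitsCarrier mu)
open Literature.NumberTheory.GaloisRepresentations.IdeleClassBar (classBarD)
open Literature.NumberTheory.GaloisRepresentations.FreePresentation
open Literature.NumberTheory.GaloisRepresentations.DGMBridge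
open scoped ContRepresentation

variable {K : Type} [Field K] [NumberField K]
variable {M : Type} [AddCommGroup M] [TopologicalSpace M] [DiscreteTopology M] [Finite M]
variable (ρ : DiscreteGaloisModule K M) (n : ℕ) (hM : ∀ m : M, n • m = 0)

/-- **The Ш²-cochain bridge, packaged** — see the module docstring for the six conjuncts.  Inputs: `hH3 : H³(K, μₙ) = 0`
(for THE application `n = p^{2M₀}`, `p` odd: `galoisCohomology_three_mu_eq_zero_of_ne_two`), `h : N₁ ⟶ C̄`, `γ ∈ Z¹(K, M)`.
[cite: MilneADT2006, I Thm. 4.10 (a) (proof, p. 58), Lemma 4.13][cite: NeukirchSchmidtWingberg2008, (1.3.2), Prop. 1.4.1, (1.5.2)] -/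
theorem exists_bridgePackage (hH3 : ∀ z : galoisCohomology (mu K n) 3, z = 0)
    (h : (presentationComplex ρ).X₁ ⟶ classBarD K) (γ : contOneCocycles ρ.toTopRep) :
    haveI := moduleFinite_presModule₁ ρ
    haveI := moduleFinite_presModule₂ ρ
    haveI := absoluteGaloisGroup_compactSpace K
    ∃ (F : contTwoCocycles (homGaloisModule ρ (units K)).toTopRep)
      (H : C(absoluteGaloisGroup K × absoluteGaloisGroup K, UnitsCarrier K))
      (c : contTwoCocycles (presModule₁ ρ).toTopRep)
      (ht : DiscreteRep.HomCarrier (LCarrier (presentationComplex ρ).X₁) (LCarrier (ideleBarD K)))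
      (Z : contTwoCocycles (toDGM (ideleBarD K)).toTopRep),
      -- (1) `Ψ h = H²(e⁻¹)[F]`
      shaTwoConnecting ρ n hM h = cohomologyMap (tateDualUnitsIso K ρ n hM).inv 2 (twoCocycleClass _ F) ∧
      -- (2) `dH = F ∪ γ`
      (∀ σ τ υ : absoluteGaloisGroup K,
        (show M →ₗ[ℤ] UnitsCarrier K from F.1 (σ, τ)) (ρ (σ * τ) (γ.1 υ)) = dTwo (units K).toTopRep H σ τ υ) ∧
      -- (3) `h̃` lifts `h` along `J̄ → C̄`
      (∀ x : LCarrier (presentationComplex ρ).X₁,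
        ideleToClassI K ((show _ →ₗ[ℤ] LCarrier (ideleBarD K) from ht) x) =
          lmap (presentationComplex ρ).X₁ (classBarD K) h x) ∧
      -- (4) `[c] = δ₁[γ]` for `0 → N₁ → P → M → 0`
      (pres_isSES ρ).δ₁ (oneCocycleClass _ γ) = twoCocycleClass _ c ∧
      -- (5) the idèle-class image of `Z` is `h ∘ c`
      (∀ σ τ : absoluteGaloisGroup K,
        ideleToClassI K (Z.1 (σ, τ)) = lmap (presentationComplex ρ).X₁ (classBarD K) h (c.1 (σ, τ))) ∧
      -- (6) the local primitives and the local comparison with `π_v Z`, on the nose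
      (∀ (v : Place K) (π : HomDual.IdeleProjection K v),
        ∃ (φ : C(absoluteGaloisGroup (Place.Completion v), DiscreteRep.HomCarrier M (UnitsCarrier (Place.Completion v))))
          (lam : C(absoluteGaloisGroup (Place.Completion v), UnitsCarrier (Place.Completion v))),
          (∀ (σ' τ' : absoluteGaloisGroup (Place.Completion v)) (z : M),
            (show M →ₗ[ℤ] UnitsCarrier (Place.Completion v) from
                homGaloisModule (GaloisRep.restrictField (Place.Completion v) ρ) (units (Place.Completion v)) σ' (φ τ')) z -
              (show M →ₗ[ℤ] UnitsCarrier (Place.Completion v) from φ (σ' * τ')) z +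
              (show M →ₗ[ℤ] UnitsCarrier (Place.Completion v) from φ σ') z =
            unitsTransfer K (Place.Completion v) ((show M →ₗ[ℤ] UnitsCarrier K from
              F.1 (absGaloisRestrict K (Place.Completion v) σ', absGaloisRestrict K (Place.Completion v) τ')) z)) ∧
          (∀ σ' τ' : absoluteGaloisGroup (Place.Completion v),
            (show M →ₗ[ℤ] UnitsCarrier (Place.Completion v) from φ σ')
                (ρ (absGaloisRestrict K (Place.Completion v) σ') (γ.1 (absGaloisRestrict K (Place.Completion v) τ'))) -
              unitsTransfer K (Place.Completion v)
                (H (absGaloisRestrict K (Place.Completion v) σ', absGaloisRestrict K (Place.Completion v) τ')) =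
            (π.toAddMonoidHom.comp (LCarrier.val (ideleBarD K)))
                (Z.1 (absGaloisRestrict K (Place.Completion v) σ', absGaloisRestrict K (Place.Completion v) τ')) -
              (units (Place.Completion v) σ' (lam τ') - lam (σ' * τ') + lam σ'))) := by
  haveI := moduleFinite_presModule₁ ρ
  haveI := moduleFinite_presModule₂ ρ
  haveI := absoluteGaloisGroup_compactSpace K
  -- the global data (G): `h̃, ξ, ξ̃, F` (its own `γ̃, c` are discarded in favour of the canonical lift below)
  obtain ⟨ht, ξ, ξt, F, -, -, hht, hξ, hξt, hF, -, -, hΨ⟩ := exists_bridgeGlobalData ρ n hM h γ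
  -- the canonical lift `γ̃` of `γ` and its connecting cocycle `c`, with `δ₁[γ] = [c]`
  let γt : C(absoluteGaloisGroup K, LCarrier (presentationComplex ρ).X₂) := (pres_isSES ρ).liftCocycle γ
  let c : contTwoCocycles (presModule₁ ρ).toTopRep :=
    (pres_isSES ρ).connectingCocycle γt ((pres_isSES ρ).liftCocycle_isLift γ)
  have hγt : ∀ σ : absoluteGaloisGroup K, presProj ρ (γt σ) = γ.1 σ := fun σ => (pres_isSES ρ).g_liftCocycle_apply γ σ
  have hc : ∀ σ τ : absoluteGaloisGroup K,
      presIncl ρ (c.1 (σ, τ)) = (presModule₂ ρ) σ (γt τ) - γt (σ * τ) + γt σ := fun σ τ =>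
    (pres_isSES ρ).f_connectingCocycle_apply γt ((pres_isSES ρ).liftCocycle_isLift γ) σ τ
  have hδ : (pres_isSES ρ).δ₁ (oneCocycleClass _ γ) = twoCocycleClass _ c := by
    have e := (pres_isSES ρ).δ₁_oneCocycleClass γt ((pres_isSES ρ).liftCocycle_isLift γ)
    rw [(pres_isSES ρ).pushCocycle_liftCocycle γ] at e
    exact e
  -- the continuous bridge cochain `B` and the global primitive `H` of `F ∪ γ` (H)
  obtain ⟨B, hB⟩ := exists_bridgeCochain ρ ht ξt γt c hc
  obtain ⟨H, hH⟩ := exists_bridgeH ρ n hM hH3 F γ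
  -- the bridge cocycle `Z = B − uJ ∘ H` (S2a)
  let Zc : C(absoluteGaloisGroup K × absoluteGaloisGroup K, LCarrier (ideleBarD K)) :=
    ⟨fun q => B q - unitsToIdeleI K (H q),
      B.continuous.sub ((unitsToIdeleI K).toContinuousLinearMap.continuous.comp H.continuous)⟩
  have hZ : ∀ σ τ : absoluteGaloisGroup K, Zc (σ, τ) = B (σ, τ) - unitsToIdeleI K (H (σ, τ)) := fun _ _ => rfl
  have hZmem : Zc ∈ contTwoCocycles (toDGM (ideleBarD K)).toTopRep :=
    bridgeCocycle_mem (presIncl ρ) (presProj ρ) (unitsToIdeleI K) ht ξ hξ ξt hξt F.1 hF γ γt hγt c.1 hc c.2 B hB H hH Zc hZ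
  -- `h̃` lifts `h`; `jC ∘ uJ = 0`
  have hlift : ∀ x : LCarrier (presentationComplex ρ).X₁,
      ideleToClassI K ((show _ →ₗ[ℤ] LCarrier (ideleBarD K) from ht) x) = lmap (presentationComplex ρ).X₁ (classBarD K) h x := by
    intro x
    have e := congrArg (fun Φ : DiscreteRep.HomCarrier (LCarrier (presentationComplex ρ).X₁) (LCarrier (classBarD K)) =>
      (show _ →ₗ[ℤ] LCarrier (classBarD K) from Φ) x) hht
    exact e
  have hjU : ∀ u : UnitsCarrier K, ideleToClassI K (unitsToIdeleI K u) = 0 := fun u => (idele_isSES K).g_f_apply u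
  refine ⟨F, H, c, ht, ⟨Zc, hZmem⟩, hΨ, hH, hlift, hδ, fun σ τ => ?_, fun v π => ?_⟩
  · -- (5)
    rw [← hlift]
    exact idele_class_of_bridgeCocycle (uJ := unitsToIdeleI K) (ideleToClassI K) hjU ht ξt γt c.1 B hB H Zc hZ σ τ
  · -- (6): the local data (L) at `v` for `π_v`, then S2b
    have hπ := ideleProjection_toDGM_smul π
    obtain ⟨ηt, φ, hηt, hφ⟩ := exists_bridgeLocalData (presIncl ρ) (presProj ρ) (pres_isSES ρ) (unitsToIdeleI K)
      (π.toAddMonoidHom.comp (LCarrier.val (ideleBarD K))) hπ ht ξ ξt hξ hξt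
    refine ⟨φ, ⟨fun σ' => (show _ →ₗ[ℤ] UnitsCarrier (Place.Completion v) from ηt)
        (γt (absGaloisRestrict K (Place.Completion v) σ')),
      (continuous_of_discreteTopology (f := fun y : LCarrier (presentationComplex ρ).X₂ =>
        (show _ →ₗ[ℤ] UnitsCarrier (Place.Completion v) from ηt) y)).comp
        (γt.continuous.comp (absGaloisRestrict K (Place.Completion v)).continuous)⟩,
      fun σ' τ' z => ?_, fun σ' τ' => ?_⟩
    · -- `dφ = ι_v F|_v` on `z = p y`
      obtain ⟨y, hy⟩ := (pres_isSES ρ).surjective z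
      change presProj ρ y = z at hy
      rw [← hy, ← ideleProjection_unitsToIdeleI π]
      exact dOne_bridgePrimitive (presProj ρ) (unitsToIdeleI K) (π.toAddMonoidHom.comp (LCarrier.val (ideleBarD K))) hπ
        ξt F.1 hF ηt φ hφ σ' τ' y
    · -- `φ ∪ γ − ι_v H = π_v Z − dλ`
      rw [← ideleProjection_unitsToIdeleI π]
      exact bridgeLocalCocycle_eq (presIncl ρ) (presProj ρ) (unitsToIdeleI K)
        (π.toAddMonoidHom.comp (LCarrier.val (ideleBarD K))) ht ξt γ γt hγt c.1 hc B hB H Zc hZ ηt hηt φ hφ σ' τ'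

end Summit.BirchSwinnertonDyer.BirchSwinnertonDyer.Theorems.ShaTwoCochain

end
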